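import Summits.QuantumFields.BalabanUV.T4Continuum.Support.ShellMeasureLandauEndAssembledDecayCfLinCoTestsSchurElb
import Summits.QuantumFields.BalabanUV.T4Continuum.Support.ShellMeasureLiveEndLevelBlindRows

/-!
# `T4Continuum.ShellMeasureLandauEndAssembledDecayCfLinCoTestsSchurCoarse` — ROW S110 «THE COARSE-BLOCKED READING OF RECORD IN THE
# KERNEL TYPE», link (3) of the owner's junction chain (R-ne7cp1-g36-12): link (2)'s most-assembled one-slot END (R11 + R10 + R05
# supplied, Schur + `hElb₁` folded) RE-FIRED with the w-tuple's position space, distance and pin FIXED to the designed reading —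
# `𝔖 := (ℤ∕Ncℤ)^d` (unit cells, ANY `Nc`), `dis := pl1`, `ϖw := pinDist Bref` —; the four reduced-rate ROW SUMS `hM𝒢′ hMι′ hMH′ hMH₁′`,
# their signs `hM·`, the pin row `hϖw` and the sign row `hdis` DERIVED from torus geometry; in their place rate gaps, placement
# multiplicities and four number junctions `mult·K ≤ M·`; everything else VERBATIM; conclusion IDENTICAL
(cell `pub-balaban`, sub-cell `t4`, spine estimate NE7c (node U5b); NE7c ROUND-2 crew `t4-ne7c-formalise-*`, unit
`b2b-balaban-t4-ne7c-formalise-leaf-03` gen 9; OFFER O-ne7cleaf03g9-1 → owner table `t4/b2b-balaban-t4-ne7c-p1/LEAVES-NE7c-P1.md` row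
**S110** (R-ne7cp1-g36-12 (3)); census rows R06∕R09∕R22 + t4-ref2's booked note C-t4r2-401 («four shared reals of THE ONE CALL are
inhabited by a READING fixed in the skeleton∕docstring, not by the kernel TYPE»); ADDITIVE — imports link (2) = S108 f3
`ShellMeasureLandauEndAssembledDecayCfLinCoTestsSchurElb` (leaf-07-g10; over S108 f2 `…Schur`, leaf-04-g11, over S104 f4 p237394) + S98
`ShellMeasureLiveEndLevelBlindRows` (p233706, leaf-01-g9) ONLY; [folklore]; 1 END theorem + G-1 numbers, 0 `def`∕`def … : Prop`∕sorry∕cite)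

HONEST FRAMING.  Finite four-torus programme, rung (B)+1 only — NOT infinite volume, NOT a mass gap, NOT the Clay problem, NOT
summit progress; (B), `BetaPertHyp`, (B^μ) not consumed.  NE7c (`T4IndicatorShell.ShellWeightBound` for the cell's expansions) is
NOT PRINTED in [Balaban 1983–89] and NOT PROVED; «NE7c ⇐ the named binders» (trigger c3); (M1) realized ≠ NE7c.  LATTICE GEOMETRY ON
OUR SIDE: what leaves the hypothesis list is the exponential row sum on a unit torus, the 1-Lipschitz torus pin and `pl1 ≥ 0` — NOT
an estimate of Bałaban's; the DECAY rows `hk𝒢 hkι hkH hkH₁` ([Balaban1985BackgroundPropagators] (3.133)∕Thm 3.3, [Balaban1985Variational]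
(46)∕(103) halves — LOCATORS, printed TYPE) REMAIN displayed, asserted by nobody; nothing printed is cited or discharged.
HONEST DEPENDENCY (cell): continuum YM on T⁴ ⇐ BetaPertH ∧ nine spine estimates (0/9 proved); BetaPertH ⇐ (D1) ∧ (D4) ∧ CAP+tail;
G-an2-4 gates asym, D1 and NE2/3/4.

THE POINT (owner census `t4/b2b-balaban-t4-ne7c-p1/ONECALL-CENSUS-NE7c.md`: R06 `hM𝒢′`, R09 `hMι′ hMH′ hMH₁′`, R22 `hϖw` — class
[T]; owner R-ne7cp1-g35-2 (a): THE DESIGNED READING OF RECORD for the w-tuple's stencil index types is COARSE-BLOCKED — `Λz Λw Λw′ Λx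
Λb` index UNIT-lattice cells of the slot's own lattice, `dis = pl1` in cell units; S98: there the row sums are `≤ m·(2(d+a)∕a)^d` for
EVERY torus size).  In every END host of record `𝔖`, `dis : 𝔖 → 𝔖 → ℝ` and the pin `ϖw : 𝔖 → ℝ` are ABSTRACT, so the four sums,
their signs, the pin's one-sided Lipschitz row and (since S108's Schur fold) `0 ≤ dis` must be DISPLAYED.  THIS FILE re-fires link (2)
`…_cfB7_lin_coTests_schur_elb` BY NAME with `𝔖 := TPt P.d Nc`, `dis := fun x y => pl1 (x − y)`, `ϖw := pinDist Bref hBref` (S69's torus pin):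
* LEAVING: data `dis ϖw` (type `𝔖`); hypotheses `hϖw` (= S69 `pinDist_le_add`), `hdis` (= `pl1_nonneg`), `hM𝒢′ hMι′ hMH′ hMH₁′`
  (= S98 `rowSum_coarse_le` ∘ the junction), `hM𝒢 hMι hMH hMH₁ : 0 ≤ M·` (positivity ∘ the junction).
* ENTERING: `Nc` (cells per direction), `Bref`, `hBref : Bref.Nonempty`; multiplicities `multw multz multx multb : ℕ` with
  `hmult· : ∀ x, #{b′ | pos· b′ = x} ≤ mult·` («≤ m indices per cell»); gaps `hgap· : δw < δ·`; junctions
  `hM·c : mult·(2(d + (δ· − δw))∕(δ· − δw))^d ≤ M·` (OUR number rows, the R10p ∕ S108 pattern) — letters `M·` and the CONCLUSION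
  IDENTICAL to link (2)'s (chain rule); RESTATED: `hk·` with `pl1 (pos· c − pos· b′)`, `hreachW hreachC hsupp hdepthw` with `pinDist`.
EXPECTED CENSUS EFFECT (owner: «T −4 (W-h's geometric rows)»; his two engines decide): `hM·′ hϖw` [T] leave (+ signs `hM·`, `hdis`).
HONEST CAVEATS.  (1) The reading t4-ref2 booked as docstring-only (C-t4r2-401) becomes the SIGNATURE: an instantiation on Bałaban's
FINE kernels must first aggregate them to unit cells (S98 «level-free iff coarse») — VISIBLE IN THE TYPE, not discharged; the decay
rows `hk·` (cell-indexed kernels) stay [T].  (2) `pinDist Bref` is S69∕S70's distance-to-a-set profile (B9 (3.133) `d(x, □)` TYPE — a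
READING); the e-leg's pins `ϖ ϖe₁ ϖe₂` are untouched; `Nc`, `Bref` are PER-SLOT data for the ONE CALL.  CONDITIONAL on every binder;
readings NOT asserted; NOT Bałaban's minimiser (node O); NOTHING in the countdown moves; NE7c NOT PROVED; spine 0∕9.
-/

noncomputable section

open Set Metric NormedSpace MeasureTheory Function

namespace Summit.QuantumFields.BalabanUV.T4Continuum.ShellMeasureLandauEndAssembledDecayCfLinCoTestsSchurCoarse

open scoped ENNReal
open Literature.MathematicalPhysics.QuantumFieldTheory.Balaban1983to89
open B11Prop6Scheme (Prop4Hyp)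
open GaugeField (GaugeInvariant)
open T4ShellMeasure (SlotAntiConcentration)
open T4CubePoincare (cube)
open T4CubeChartGnomonic (SU2)
open T4CubeChartExp (expFibreChart)
open T4TreeGaugeFixing (fixTo)
open T4ShellMeasurePlaquette (expTail₂)
open ShellMeasureLevelAssembly (classifier)
open ShellMeasureMultiGridNorms (WSup)
open ShellMeasureMultiGridNorms.WSup (toPiL)
open ShellMeasurePinnedNorm (pinW pinDist pinDist_le_add)
open ShellMeasureLandauHolonomy (solAt landauExp)
open ShellMeasureLandauHolonomyChart (holOf cplx)
open ShellMeasureLandauHolonomySkew (readOutReal)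
open ShellMeasureDecayKernelSums (kerOp)
open T4AxialGaugeSmallField (boxPlaqs boxBonds)
open T4AxialGaugeFixing (combBonds)
open B7Prop2Explicit (C0 c2' unitaryUnits)
open B7Prop1Local (pdevOn loK bondHiK)
open B7Prop5Flat (BondIn)
open ShellMeasureAverageProp4General (O1cov C2cov)
open ShellMeasureLandauCorrectionB7 (landauCf landauRad)
open ShellMeasureLandauCorrectionReal (skewPi)
open ShellMeasureLandauCfBoxLocal (landauCfBox)
open ShellMeasureLandauEndAssembledDecayCfLinCoTestsSchurElb (slotAC_realized_su2_landauChart_assembled_decay_cfB7_lin_coTests_schur_elb)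
open ShellMeasureLiveEndLevelBlindRows (rowSum_coarse_le)
open TreeLengthTorus (TPt)
open B12Decay510Torus (pl1 pl1_nonneg)

section Box

open scoped Matrix.Norms.L2Operator

variable {P : Params} {j : ℕ} [DecidableEq (PBond P j)]
variable {n : Type*} [Fintype n] [DecidableEq n] [Nonempty n]
variable {𝒴 𝒵 ℬ : Type*} [NormedAddCommGroup 𝒴] [NormedSpace ℂ 𝒴] [CompleteSpace 𝒴]
  [NormedAddCommGroup 𝒵] [NormedSpace ℂ 𝒵] [NormedAddCommGroup ℬ] [NormedSpace ℂ ℬ]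
variable {𝔸 : Type*} [CStarAlgebra 𝔸] [Nontrivial 𝔸]

/-- **ROW S110 — THE MOST-ASSEMBLED ONE-SLOT END (R11, R10, R05 supplied; Schur + `hElb₁` folded) WITH THE COARSE-BLOCKED READING
IN THE TYPE** — link (2) `…_cfB7_lin_coTests_schur_elb` with `𝔖 := TPt P.d Nc`, `dis := fun x y => pl1 (x − y)`, `ϖw := pinDist Bref
hBref`: `hϖw` (`pinDist_le_add`), `hdis` (`pl1_nonneg`), the four row sums `hM·′` (S98 `rowSum_coarse_le`) and the signs `hM·` DERIVED;
DISPLAYED instead `Bref`, the multiplicities `hmult·`, the gaps `hgap·`, the junctions `hM·c`; everything else VERBATIM; conclusion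
IDENTICAL.  CONDITIONAL on every binder; readings NOT asserted; NOT Bałaban's minimiser (node O); (M1) realized ≠ NE7c. [folklore] -/
theorem slotAC_realized_su2_landauChart_assembled_decay_cfB7_lin_coTests_schur_elb_coarse
    -- the BOX `[lo, hi]` (the block `□^{∼4}`: `nb` unit steps per direction, non-wrapping on the torus) and its axial comb
    {lo hi : Fin P.d → ℤ} {nb : ℕ} (hn : ∀ κ, hi κ ≤ lo κ + nb) (hN : ∀ κ, hi κ - lo κ < P.sitesPerDir j)
    (Λ : Finset (PBond P j)) (hΛbox : ∀ b ∈ Λ, b ∈ boxBonds lo hi) (hΛcomb : Disjoint Λ (combBonds lo hi))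
    {m₀ : ℕ} (e : ↥Λ × Fin 3 ≃ Fin m₀)
    {S : ℝ} (hS : 0 < S) (hSπ : 3 * S ^ 2 < Real.pi ^ 2)
    {F : GaugeField P j SU2 → ℝ≥0∞} (hF : Measurable F) (hFi : GaugeInvariant F)
    {u : GaugeField P j SU2 → ℝ} (hu : Measurable u) (hui : GaugeInvariant u)
    {ι : Type*} {Pu : Finset ι} (hPu : Pu.Nonempty)
    -- ══ R05 SUPPLIED (S104 f4): window `W V := closedBall 0 S`, co-test `Jco V :=` the NEIGHBOURS' KEPT (2.17)-indicators on the
    -- S-ball (S94 `ShellMeasureCoTestStarShaped.jco_triple_of_neighbours`) — `hJW hJ hJ1 hWS` DISCHARGED; DISPLAYED in their place the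
    -- per-neighbour families: neighbours `N`, plaquettes `PuN`, holonomies `holN` read on OUR chart, thresholds∕radii∕bounds∕deltas,
    -- (SM)_i in S94's currency, and (AN-bound)_i on our rays (W-a TYPE — the straddling cubes' localized minimisers; displayed) ══
    {κN : Type*} (N : Finset κN) {ιN : κN → Type*} {PuN : (i : κN) → Finset (ιN i)} (hPuN : ∀ i, (PuN i).Nonempty)
    {AN : Type*} [NormedRing AN] [NormedAlgebra ℂ AN] [CompleteSpace AN]
    (holN : (i : κN) → GaugeField P j SU2 → ιN i → (Fin m₀ → ℝ) → AN) {θN RN HN δN : κN → ℝ}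
    (hRN : ∀ i ∈ N, 1 < RN i) (hθN : ∀ i ∈ N, 0 < θN i) (hδ0N : ∀ i ∈ N, 0 ≤ δN i) (hδ1N : ∀ i ∈ N, δN i ≤ 1)
    (hSMN : ∀ i ∈ N, 36 * HN i * 1 ^ 2 / (RN i - 1) ^ 2 ≤ δN i * θN i)
    (hANN : ∀ i ∈ N, ∀ V, ∀ x ∈ closedBall (0 : Fin m₀ → ℝ) S, ∀ p ∈ PuN i, ∃ f : ℂ → AN,
      DifferentiableOn ℂ f (ball 0 (RN i)) ∧ (∀ w ∈ ball (0 : ℂ) (RN i), ‖f w‖ ≤ HN i) ∧ f 0 = 0 ∧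
      ∀ c : ℝ, 0 ≤ c → c ≤ 1 → f (c : ℂ) = holN i V p (c • x) - 1)
    {δ ρ β : ℝ}
    (𝒢 : GaugeField P j SU2 → (𝒵 →L[ℂ] 𝒴)) (W𝒱 : GaugeField P j SU2 → 𝒴 → 𝒵) {B₀ C₄ a₃ ε₄ : ℝ}
    (h𝒢 : ∀ V f, ‖𝒢 V f‖ ≤ B₀ * ‖f‖) (hW : ∀ V, Prop4Hyp (W𝒱 V) C₄ a₃) (hB₀ : 0 < B₀) (hC₄ : 0 ≤ C₄)
    (hε₄ : 0 ≤ ε₄)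
    {dL C₁ B₃ ε₁ : ℝ} (hdL : 0 ≤ dL) (hC₁ : 0 ≤ C₁) (hε₁ : 0 ≤ ε₁) (hB₃ : dL ≤ B₃)
    (h1 : 2 * B₀ * C₁ * B₃ * ε₁ ≤ ε₄) (h2 : 4 * ε₄ ≤ a₃) (h3 : 16 * B₀ * C₄ * ε₄ ≤ 1)
    (H₁ : GaugeField P j SU2 → (ℬ →L[ℂ] 𝒴)) (hH₁ : ∀ V B, ‖H₁ V B‖ ≤ B₀ * ‖B‖)
    -- ══ R10 SUPPLIED (S104 f2): the u-tuple's coarse-datum map IS a bounded complex-LINEAR map `T V` read on the chart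
    -- coordinates — its three analytic binders `hΦd hΦ0 hΦ` are DISCHARGED (`ShellMeasureLinearChartMap`); DISPLAYED in
    -- their place: ONE number relation «operator norm × polydisc radius < B11's `b = 2dLC₁ε₁`» ══
    (T : GaugeField P j SU2 → ((Fin m₀ → ℂ) →L[ℂ] ℬ)) {rΦ : ℝ} (hTb : ∀ V, ‖T V‖ * rΦ < 2 * dL * C₁ * ε₁) (hSr : S < rΦ)
    -- ══ R11 SUPPLIED (row S99, γ14): the THREE Landau-correction letters ARE the tree's `C_k` of [B7] Prop. 4 in the
    -- `A`-currency (S64 `landauCf`), all with `C₂ := C2cov d`, `RC := landauRad d L`: u-tuple (LOCALIZED, flat background —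
    -- its plaquette variables are words of the exponent field alone) `Cf V := (ball 0 RC).indicator (C_k(1, ·))`, NOTHING
    -- displayed in its place; w-tuple (GLOBAL minimiser, flat pi-types) `Cw V := landauCfBox L (Ubg V) k Sw Sw′ RC` (cut off
    -- PER OUTPUT BOND on its box — exact locality `hlocC` by `landauCfBox_local`); e-tuple (GLOBAL minimiser, pinned) `Ce V :=`
    -- CfP's conjugate of `C_k(Ubg V, ·)` with `C₂e := C2cov d·e^{2δ′r₀e}`.  `hC₂ hCq hCd hCr h𝓡𝒳 ∕ hC₂w hCqw hCdw hlocC hCrw h𝓡𝒳w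
    -- ∕ hC₂e hCqe hCde` DISCHARGED (f1 §5, f3a §2–§3).  DISPLAYED IN THEIR PLACE (w∕e only): the global minimiser's background
    -- `Ubg V` on `ℤᵈ` (unitary-valued) and its plaquette regularity ON THE BOXES of the two output index sets ONLY — `h52locw`,
    -- `h52loce` (B11 Thm 1 ∕ (19)–(21) TYPE, class T until node O reads it off the co-tests) — four LEVEL-FREE numbers on `α₀`
    -- (class D), the e-letter's two pin profiles with CfP's reach `r₀e` ([R]); [dict]: `k` = the slot's level ══
    (k : ℕ) (Sf Sf' Sw Sw' Se Se' : Finset (B7Prop1Explicit.Site P.d × Fin P.d))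
    (Ubg : GaugeField P j SU2 → B7Prop1Explicit.Site P.d → Fin P.d → 𝔸ˣ) (hUbg : ∀ V x κ, Ubg V x κ ∈ unitaryUnits 𝔸)
    {α₀ : ℝ} (hα : 0 < α₀) (hα3 : C0 P.d * α₀ ≤ 1 / 3) (hα4 : 4 * α₀ ≤ c2' P.d P.L) (hα6 : 4 * O1cov P.d * α₀ ≤ 1 / 3)
    (h52locw : ∀ V (c : ↥Sw'),
      pdevOn (loK P.L k c.1.1) (bondHiK P.L k c.1.1 c.1.2) (Ubg V) < α₀ * (((P.L : ℝ) ^ k)⁻¹) ^ 2)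
    (h52loce : ∀ V (c : ↥Se'),
      pdevOn (loK P.L k c.1.1) (bondHiK P.L k c.1.1 c.1.2) (Ubg V) < α₀ * (((P.L : ℝ) ^ k)⁻¹) ^ 2)
    (ϖe₁ : ↥Se → ℝ) (ϖe₂ : ↥Se' → ℝ) (hϖe₁ : ∀ b, 0 ≤ ϖe₁ b) (hϖe₂ : ∀ c, 0 ≤ ϖe₂ c) {r₀e : ℝ}
    (hreache : ∀ (c : ↥Se') (s : ↥Se),
      BondIn (loK P.L k c.1.1) (bondHiK P.L k c.1.1 c.1.2) s.1.1 s.1.2 → ϖe₂ c - r₀e ≤ ϖe₁ s)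
    (ιs : GaugeField P j SU2 → (𝒴 →L[ℂ] (↥Sf → 𝔸))) (hι : ∀ V Y, ‖ιs V Y‖ ≤ ‖Y‖)
    (Hop : GaugeField P j SU2 → ((↥Sf' → 𝔸) →L[ℂ] 𝒴)) (hH : ∀ V X, ‖Hop V X‖ ≤ B₀ * ‖X‖)
    {ε₃ : ℝ} (h18 : 18 * C2cov P.d * B₀ * ε₃ ≤ 1) (hcoup : ε₄ + B₀ * (2 * dL * C₁ * ε₁) ≤ ε₃)
    (h3R : 3 * ε₃ ≤ landauRad P.d P.L)
    (ℓs : ι → List (𝒴 →L[ℂ] Matrix n n ℂ)) {κr : ℝ} (hκ : 0 ≤ κr)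
    (hℓ : ∀ p ∈ Pu, ∀ ℓ ∈ ℓs p, ∀ Y, ‖ℓ Y‖ ≤ κr * ‖Y‖) {m : ℕ} (hlen : ∀ p ∈ Pu, (ℓs p).length ≤ m)
    {κc : ℝ} (hκc : 0 ≤ κc) (hcurl : ∀ p ∈ Pu, ∀ Y, ‖((ℓs p).map fun ℓ => ℓ Y).sum‖ ≤ κc * ‖Y‖)
    -- ══ (T2) THE WILSON SLOT'S SUPPLIER DATA AT THE READING OF RECORD (file 4
    -- `ShellMeasureLandauWilsonSquaresKernelsSchwarz.hE_landau_wilsonSquares_located_schwarz_of_decay`, per exterior section `V`,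
    -- V-uniform constants): five FLAT pi-type chain spaces, ONE pin profile on a common position space (one-sided Lipschitz),
    -- the four linear letters as V-indexed DECAY KERNELS with reduced-rate row sums ((3.133)∕Thm 3.3, (46), (103) decay-halves
    -- TYPE — LOCATORS), the flat printed-TYPE lists, two localities with reaches, the block support of the coarse field, blind
    -- flat read-outs, the located count — NOTHING PINNED DISPLAYED; the Wilson budget LOCATED and SECOND ORDER (γ6) ══
    {Λw Λz Λb : Type*} [Fintype Λw] [DecidableEq Λw] [Fintype Λz] [Fintype Λb]
    {𝔄w ℭ 𝔇 : Type*} [NormedAddCommGroup 𝔄w] [NormedSpace ℂ 𝔄w] [CompleteSpace 𝔄w]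
    [NormedAddCommGroup ℭ] [NormedSpace ℂ ℭ] [NormedAddCommGroup 𝔇] [NormedSpace ℂ 𝔇]
    -- ══ THE COARSE-BLOCKED READING OF RECORD IN THE TYPE (this file): positions in the UNIT torus `(ℤ∕Ncℤ)^d` of the slot's
    -- cells (ANY `Nc`), distance `pl1 (x − y)` (periodic ℓ¹, cell units), pin `pinDist Bref` to a displayed reference cell set
    -- `Bref`; the one-sided Lipschitz row `hϖw` and the sign row `0 ≤ dis` are KERNEL (`pinDist_le_add`, `pl1_nonneg`) ══
    {δw : ℝ} (hδw : 0 ≤ δw) {Nc : ℕ} [NeZero Nc] (Bref : Finset (TPt P.d Nc)) (hBref : Bref.Nonempty)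
    (pos : Λw → TPt P.d Nc) (posz : Λz → TPt P.d Nc) (pos' : ↥Sw → TPt P.d Nc) (posx : ↥Sw' → TPt P.d Nc)
    (posb : Λb → TPt P.d Nc)
    -- placement multiplicities of the four summed index sets («≤ mult· indices per cell», S98's letter `m`; DISPLAYED)
    {multw multz multx multb : ℕ} (hmultw : ∀ x, (Finset.univ.filter fun b' => pos b' = x).card ≤ multw)
    (hmultz : ∀ x, (Finset.univ.filter fun b' => posz b' = x).card ≤ multz)
    (hmultx : ∀ x, (Finset.univ.filter fun b' => posx b' = x).card ≤ multx)
    (hmultb : ∀ x, (Finset.univ.filter fun b' => posb b' = x).card ≤ multb)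
    (k𝒢 : GaugeField P j SU2 → Λw → Λz → (ℭ →L[ℂ] 𝔄w)) (kι : GaugeField P j SU2 → ↥Sw → Λw → (𝔄w →L[ℂ] 𝔸))
    (kH : GaugeField P j SU2 → Λw → ↥Sw' → (𝔸 →L[ℂ] 𝔄w)) (kH₁ : GaugeField P j SU2 → Λw → Λb → (𝔇 →L[ℂ] 𝔄w))
    {c𝒢 δ𝒢 M𝒢 cι δι Mι cH δH MH cH₁ δH₁ MH₁ : ℝ}
    -- the four DECAY rows stay DISPLAYED (printed TYPE — the W-h CONTENT, now about CELL-indexed kernels); their reduced-rate ROW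
    -- SUMS `hM·′` and signs `hM·` are DERIVED (S98 `rowSum_coarse_le`: `Σ_{b′} e^{−a·pl1(x − pos· b′)} ≤ mult·(2(d+a)∕a)^d`, NO
    -- `Nc`) — in their place: the rate GAPS `δw < δ·` and the NUMBER JUNCTIONS `mult·(2(d + (δ·−δw))∕(δ·−δw))^d ≤ M·`
    (hc𝒢 : 0 ≤ c𝒢) (hk𝒢 : ∀ V c b', ‖k𝒢 V c b'‖ ≤ c𝒢 * Real.exp (-(δ𝒢 * pl1 (pos c - posz b'))))
    (hgap𝒢 : δw < δ𝒢) (hM𝒢c : (multz : ℝ) * (2 * ((P.d : ℝ) + (δ𝒢 - δw)) / (δ𝒢 - δw)) ^ P.d ≤ M𝒢)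
    (hcι : 0 ≤ cι) (hkι : ∀ V c b', ‖kι V c b'‖ ≤ cι * Real.exp (-(δι * pl1 (pos' c - pos b'))))
    (hgapι : δw < δι) (hMιc : (multw : ℝ) * (2 * ((P.d : ℝ) + (δι - δw)) / (δι - δw)) ^ P.d ≤ Mι)
    (hcH : 0 ≤ cH) (hkH : ∀ V c b', ‖kH V c b'‖ ≤ cH * Real.exp (-(δH * pl1 (pos c - posx b'))))
    (hgapH : δw < δH) (hMHc : (multx : ℝ) * (2 * ((P.d : ℝ) + (δH - δw)) / (δH - δw)) ^ P.d ≤ MH)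
    (hcH₁ : 0 ≤ cH₁) (hkH₁ : ∀ V c b', ‖kH₁ V c b'‖ ≤ cH₁ * Real.exp (-(δH₁ * pl1 (pos c - posb b'))))
    (hgapH₁ : δw < δH₁) (hMH₁c : (multb : ℝ) * (2 * ((P.d : ℝ) + (δH₁ - δw)) / (δH₁ - δw)) ^ P.d ≤ MH₁)
    -- the flat lists (P4)∕(118)∕(121)∕(75)-TYPE∕(44) at radius `RCw` with `6(ε₄w + B₀w·bw) ≤ RCw`∕scaling∕(54); ══ S108 f2: the
    -- three sup-norm operator rows `h𝒢w hH₁w hHw` of S104 f4 are DERIVED (Schur test of the decay rows above) — in their place the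
    -- NUMBER JUNCTIONS `c𝒢·M𝒢 ≤ B₀w`, `cH₁·MH₁ ≤ B₀w`, `cH·MH ≤ B₀w` ══
    (W𝒱w : GaugeField P j SU2 → (Λw → 𝔄w) → (Λz → ℭ)) {B₀w C₄w a₃w ε₄w bw : ℝ}
    (hB𝒢w : c𝒢 * M𝒢 ≤ B₀w) (hWw : ∀ V, Prop4Hyp (W𝒱w V) C₄w a₃w) (hB₀w : 0 < B₀w) (hC₄w : 0 ≤ C₄w)
    (hε₄w : 0 ≤ ε₄w) (hdomw : 2 * (ε₄w + B₀w * bw) ≤ a₃w) (hselfw : B₀w * C₄w * (ε₄w + B₀w * bw) ^ 2 ≤ ε₄w)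
    (hcontrw : 4 * B₀w * C₄w * (ε₄w + B₀w * bw) < 1) (hBH₁w : cH₁ * MH₁ ≤ B₀w)
    -- ══ R10 SUPPLIED: the w-tuple's coarse-datum map is a bounded LINEAR map into the flat pi-type; ONE number relation ══
    (Tw : GaugeField P j SU2 → ((Fin m₀ → ℂ) →L[ℂ] (Λb → 𝔇))) {rΦw : ℝ} (hTbw : ∀ V, ‖Tw V‖ * rΦw < bw)
    (h2Sw : 2 * S ≤ rΦw)
    (hιw : ∀ V Y, ‖kerOp (kι V) Y‖ ≤ ‖Y‖) (hBHw : cH * MH ≤ B₀w)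
    (hqw : 9 * C2cov P.d * B₀w * (ε₄w + B₀w * bw) < 1) (hRCw : 6 * (ε₄w + B₀w * bw) ≤ landauRad P.d P.L)
    -- localities with reaches, the block support, the two contraction numbers (DISPLAYED arithmetic on the decay constants)
    (NW : Λz → Λw → Prop)
    (hlocW : ∀ V, ∀ A A' : Λw → 𝔄w, ∀ c', (∀ b', NW c' b' → A b' = A' b') → W𝒱w V A c' = W𝒱w V A' c')
    {rW : ℝ} (hreachW : ∀ c' b', NW c' b' → pinDist Bref hBref (posz c') - rW ≤ pinDist Bref hBref (pos b'))
    {rC : ℝ} (hreachC : ∀ (c' : ↥Sw') (b' : ↥Sw),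
      BondIn (loK P.L k c'.1.1) (bondHiK P.L k c'.1.1 c'.1.2) b'.1.1 b'.1.2 →
        pinDist Bref hBref (posx c') - rC ≤ pinDist Bref hBref (pos' b'))
    (hsupp : ∀ V, ∀ z : Fin m₀ → ℂ, ∀ i, 0 < pinDist Bref hBref (posb i) → Tw V z i = 0)
    (hqW : c𝒢 * M𝒢 * (2 * C₄w * a₃w * Real.exp (δw * rW)) < 1)
    (hk : 2 * C2cov P.d * landauRad P.d P.L * Real.exp (δw * rC) * (cι * Mι) * (cH * MH) < 1)
    -- weight plaquettes; read-outs BLIND off located supports, FLAT op-norms, curl op-norm (DISPLAYED; `κ_c ∝ η²`), lengths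
    {𝔭 : Type*} (Pw : Finset 𝔭) (ℓw : 𝔭 → List ((Λw → 𝔄w) →L[ℂ] Matrix n n ℂ)) (suppw : 𝔭 → Finset Λw)
    (ϖPw : 𝔭 → ℝ)
    (hblindw : ∀ p ∈ Pw, ∀ ℓ ∈ ℓw p, ∀ A A' : Λw → 𝔄w, (∀ b' ∈ suppw p, A b' = A' b') → ℓ A = ℓ A')
    (hdepthw : ∀ p ∈ Pw, ∀ b' ∈ suppw p, ϖPw p ≤ pinDist Bref hBref (pos b')) (hϖPw : ∀ p ∈ Pw, 0 ≤ ϖPw p)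
    {κwb κcb : ℝ} (hκwb : 0 ≤ κwb) (hκcb : 0 ≤ κcb) (hℓwb : ∀ p ∈ Pw, ∀ ℓ ∈ ℓw p, ‖ℓ‖ ≤ κwb)
    (hcurlw : ∀ p ∈ Pw, ‖(ℓw p).sum‖ ≤ κcb)
    {mw : ℕ} (hlenw : ∀ p ∈ Pw, (ℓw p).length ≤ mw)
    -- the global tuple's real structure with SKEW weight read-outs
    (𝓡𝒴w : AddSubgroup (Λw → 𝔄w)) (h𝓡𝒴w : IsClosed (𝓡𝒴w : Set (Λw → 𝔄w))) (𝓡𝒵w : AddSubgroup (Λz → ℭ))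
    (𝓡ℬw : AddSubgroup (Λb → 𝔇))
    (h𝒢rw : ∀ V, ∀ f ∈ 𝓡𝒵w, kerOp (k𝒢 V) f ∈ 𝓡𝒴w) (hWrw : ∀ V, ∀ Y ∈ 𝓡𝒴w, W𝒱w V Y ∈ 𝓡𝒵w)
    (hιrw : ∀ V, ∀ Y ∈ 𝓡𝒴w, kerOp (kι V) Y ∈ skewPi ↥Sw)
    (hHrw : ∀ V, ∀ X ∈ skewPi (𝔸 := 𝔸) ↥Sw', kerOp (kH V) X ∈ 𝓡𝒴w)
    (hH₁rw : ∀ V, ∀ B ∈ 𝓡ℬw, kerOp (kH₁ V) B ∈ 𝓡𝒴w)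
    (hTrw : ∀ V (y : Fin m₀ → ℝ), Tw V (cplx y) ∈ 𝓡ℬw)
    (hskew : ∀ p ∈ Pw, ∀ ℓ ∈ ℓw p, ∀ Y ∈ 𝓡𝒴w, ℓ Y ∈ skewAdjoint (Matrix n n ℂ))
    -- the frozen background plaquettes (N-ne7cp1-g31-2) with a uniform size bound, the located count, `0 ≤ β`
    (Bp : GaugeField P j SU2 → 𝔭 → Matrix n n ℂ) {d : 𝔭 → ℝ} {dbar : ℝ}
    (hBu : ∀ V, ∀ p ∈ Pw, Bp V p ∈ unitary (Matrix n n ℂ)) (hBd : ∀ V, ∀ p ∈ Pw, ‖Bp V p - 1‖ ≤ d p)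
    (hd : ∀ p ∈ Pw, d p ≤ dbar) (hdbar : 0 ≤ dbar)
    {Kw : ℝ} (hKw : ∑ p ∈ Pw, Real.exp (-(δw * ϖPw p)) ≤ Kw)
    -- ══ (T3) THE LOCATED NON-WILSON TERMS' SUPPLIER DATA (S71 f2 `hE_landau_chartRay_pinned`): the global tuple's PINNED
    -- INSTANCE `𝒴 := WSup (pinW δ′ ϖ) 1 𝔄`, located per-term functionals, pin depths, located sum `LK`, coupling ══
    {Λe : Type*} [Fintype Λe] {𝔄 : Type*} [NormedAddCommGroup 𝔄] [NormedSpace ℂ 𝔄] [CompleteSpace 𝔄] {δ' : ℝ} {ϖ : Λe → ℝ}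
    (hδ' : 0 ≤ δ') (hϖ : ∀ b', 0 ≤ ϖ b')
    {𝒵e ℬe : Type*} [NormedAddCommGroup 𝒵e] [NormedSpace ℂ 𝒵e] [NormedAddCommGroup ℬe] [NormedSpace ℂ ℬe]
    (𝒢e : GaugeField P j SU2 → (𝒵e →L[ℂ] WSup (pinW δ' ϖ) 1 𝔄)) (W𝒱e : GaugeField P j SU2 → WSup (pinW δ' ϖ) 1 𝔄 → 𝒵e)
    {B₀e C₄e a₃e be ε₄e : ℝ}
    (h𝒢e : ∀ V f, ‖𝒢e V f‖ ≤ B₀e * ‖f‖) (hWe : ∀ V, Prop4Hyp (W𝒱e V) C₄e a₃e) (hB₀e : 0 < B₀e) (hC₄e : 0 ≤ C₄e)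
    (hbe : 0 ≤ be) (hε₄e : 0 ≤ ε₄e) (hdome : 2 * (ε₄e + B₀e * be) ≤ a₃e)
    (hselfe : B₀e * C₄e * (ε₄e + B₀e * be) ^ 2 ≤ ε₄e) (hcontre : 4 * B₀e * C₄e * (ε₄e + B₀e * be) < 1)
    (H₁e : GaugeField P j SU2 → (ℬe →L[ℂ] WSup (pinW δ' ϖ) 1 𝔄)) (hH₁e : ∀ V B, ‖H₁e V B‖ ≤ B₀e * ‖B‖)
    -- ══ R10 SUPPLIED: the e-tuple's coarse-datum map is a bounded LINEAR map; ONE number relation ══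
    (Te : GaugeField P j SU2 → ((Fin m₀ → ℂ) →L[ℂ] ℬe)) {rΦe : ℝ} (hTbe : ∀ V, ‖Te V‖ * rΦe < be) (hSre : S < rΦe)
    (ιe : GaugeField P j SU2 → (WSup (pinW δ' ϖ) 1 𝔄 →L[ℂ] WSup (pinW δ' ϖe₁) 1 𝔸)) (hιe : ∀ V Y, ‖ιe V Y‖ ≤ ‖Y‖)
    (He : GaugeField P j SU2 → (WSup (pinW δ' ϖe₂) 1 𝔸 →L[ℂ] WSup (pinW δ' ϖ) 1 𝔄)) (hHe : ∀ V X, ‖He V X‖ ≤ B₀e * ‖X‖)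
    (hqe : 9 * (C2cov P.d * Real.exp (2 * δ' * r₀e)) * B₀e * (ε₄e + B₀e * be) < 1)
    (hRCe : 3 * (ε₄e + B₀e * be) ≤ landauRad P.d P.L)
    {𝔱 : Type*} (I : Finset 𝔱) {Ef : 𝔱 → (Λe → 𝔄) → ℂ} {rE : ℝ} {ee : 𝔱 → ℝ} (hrE : 0 < rE)
    (hEd : ∀ i ∈ I, DifferentiableOn ℂ (Ef i) (ball 0 rE))
    (hEb : ∀ i ∈ I, ∀ Z ∈ ball (0 : Λe → 𝔄) rE, ‖Ef i Z‖ ≤ ee i)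
    (supp : 𝔱 → Finset Λe) (hblind : ∀ i ∈ I, ∀ A₁ A₂ : Λe → 𝔄, (∀ b' ∈ supp i, A₁ b' = A₂ b') → Ef i A₁ = Ef i A₂)
    (ϖP : 𝔱 → ℝ) (hdepth : ∀ i ∈ I, ∀ b' ∈ supp i, ϖP i ≤ ϖ b')
    {LK : ℝ} (hK : ∑ i ∈ I, 2 * ee i / rE * Real.exp (-(δ' * ϖP i)) ≤ LK)
    (hcoupE : ((ε₄e + B₀e * be) + B₀e * (4 * (C2cov P.d * Real.exp (2 * δ' * r₀e)) * (ε₄e + B₀e * be) ^ 2)) ≤ rE / 2)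
    -- ══ (S78) THE FLUCTUATION-DRESSED TERMS: `−log ∫ g e^{A} dμ` with an ω-UNIFORM ray constant `B_d`, integrability and
    -- positivity of the dressed integral, a lower bound on the S-ball (all DISPLAYED) ══
    {Ω : Type*} [MeasurableSpace Ω] (μ : Measure Ω) {g : Ω → ℝ} (hg : ∀ ω, 0 ≤ g ω)
    (A : GaugeField P j SU2 → (Fin m₀ → ℝ) → Ω → ℝ) {Bd : ℝ}
    (hint : ∀ V, ∀ x ∈ closedBall (0 : Fin m₀ → ℝ) S, ∀ c : ℝ, 1 / 2 ≤ c → c ≤ 1 →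
      Integrable (fun ω => g ω * Real.exp (A V (c • x) ω)) μ)
    (hpos : ∀ V, ∀ x ∈ closedBall (0 : Fin m₀ → ℝ) S, ∀ c : ℝ, 1 / 2 ≤ c → c ≤ 1 →
      0 < ∫ ω, g ω * Real.exp (A V (c • x) ω) ∂μ)
    (hA : ∀ V, ∀ x ∈ closedBall (0 : Fin m₀ → ℝ) S, ∀ c : ℝ, 1 / 2 ≤ c → c ≤ 1 →
      ∀ ω, A V x ω ≤ A V (c • x) ω + (1 - c) * Bd)
    {BE₂ : ℝ} (hElb₂ : ∀ V (y : Fin m₀ → ℝ), ‖y‖ ≤ S → -BE₂ ≤ (-Real.log (∫ ω, g ω * Real.exp (A V y ω) ∂μ)))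
    (L : Set (𝒴 →L[ℂ] Matrix n n ℂ))
    (𝓡𝒵 : AddSubgroup 𝒵) (𝓡ℬ : AddSubgroup ℬ)
    (h𝒢r : ∀ V, ∀ f ∈ 𝓡𝒵, 𝒢 V f ∈ readOutReal L) (hWr : ∀ V, ∀ Y ∈ readOutReal L, W𝒱 V Y ∈ 𝓡𝒵)
    (hιr : ∀ V, ∀ Y ∈ readOutReal L, ιs V Y ∈ skewPi ↥Sf)
    (hHr : ∀ V, ∀ X ∈ skewPi (𝔸 := 𝔸) ↥Sf', Hop V X ∈ readOutReal L)
    (hH₁r : ∀ V, ∀ B ∈ 𝓡ℬ, H₁ V B ∈ readOutReal L)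
    (hTr : ∀ V (y : Fin m₀ → ℝ), T V (cplx y) ∈ 𝓡ℬ)
    (hRdict : ∀ V, ∀ x ∈ cube m₀ S,
      F (fixTo (combBonds lo hi) 1 (updateFinset V Λ (expFibreChart Λ 1 e x))) =
        (closedBall (0 : Fin m₀ → ℝ) S ∩ ⋂ i ∈ N, {y | classifier (hPuN i) (holN i V) y < θN i}).indicator (1 : (Fin m₀ → ℝ) → ℝ≥0∞) x *
          ENNReal.ofReal (Real.exp (-((∑ p ∈ Pw, β * (1 - (Matrix.trace (Bp V p * holOf (ℓw p)
            (fun y => landauExp (landauCfBox P.L (Ubg V) k Sw Sw' (landauRad P.d P.L)) (kerOp (kι V)) (kerOp (kH V))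
              (4 * C2cov P.d * (ε₄w + B₀w * bw) ^ 2)
              (solAt (kerOp (k𝒢 V)) 0 (W𝒱w V) ε₄w (0 : Λz → ℭ) (kerOp (kH₁ V) (Tw V (cplx y))) +
                kerOp (kH₁ V) (Tw V (cplx y)))) x)).re /
            Fintype.card n)) +
          ((∑ i ∈ I, Ef i (WSup.toPiL (𝔄 := 𝔄) (pinW δ' ϖ) 1
            (landauExp (fun Y : WSup (pinW δ' ϖe₁) 1 𝔸 =>
            ((toPiL (pinW δ' ϖe₂) 1).symm (landauCf P.L (Ubg V) k Se Se' (toPiL (pinW δ' ϖe₁) 1 Y)) :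
              WSup (pinW δ' ϖe₂) 1 𝔸)) (ιe V) (He V)
            (4 * (C2cov P.d * Real.exp (2 * δ' * r₀e)) * (ε₄e + B₀e * be) ^ 2)
              (solAt (𝒢e V) 0 (W𝒱e V) ε₄e (0 : 𝒵e) (H₁e V (Te V (cplx x))) + H₁e V (Te V (cplx x)))))).re +
          (-Real.log (∫ ω, g ω * Real.exp (A V x ω) ∂μ)))))))
    (hudict : ∀ V, ∀ x ∈ cube m₀ S,
      u (fixTo (combBonds lo hi) 1 (updateFinset V Λ (expFibreChart Λ 1 e x))) =
        classifier hPu (fun p => holOf (ℓs p) (fun y => landauExp ((ball (0 : ↥Sf → 𝔸) (landauRad P.d P.L)).indicator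
            (landauCf P.L (1 : B7Prop1Explicit.Site P.d → Fin P.d → 𝔸ˣ) k Sf Sf')) (ιs V) (Hop V)
          (4 * C2cov P.d * (ε₄ + B₀ * (2 * dL * C₁ * ε₁)) ^ 2)
          (solAt (𝒢 V) 0 (W𝒱 V) ε₄ (0 : 𝒵) (H₁ V (T V (cplx y))) + H₁ V (T V (cplx y))))) x)
    (hδ0 : 0 ≤ δ) (hδ1 : δ < 1) (hρ0 : 0 ≤ ρ) (hρ : ρ ≤ (1 - δ) / 2) (hβ : 0 ≤ β)
    -- SM-L2 (SM) DISCHARGED IN THE STOKES CURRENCY (S73 `hSM_of_stokes`): the η-scalings of the classifier's read-out data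
    -- DISPLAYED — curl read-out × field size `κ_c·z̄ ≤ c₁η²z` (B11 (25)∕(37) TYPE), letter size `κ_r·z̄ ≤ c₂ηz` ((19) TYPE),
    -- regime `m·κ_r·z̄ ≤ 1` — the UNIT-currency smallness `36(c₁z + m²c₂²z²)∕(r_Φ∕S − 1)² ≤ δ·εθ`, and the classifier
    -- threshold `θ := εθ·η²` (B14 (2.17) TYPE): the `η²` CANCELS
    {η εθ c₁ c₂ z : ℝ} (hη : 0 < η) (hεθ : 0 < εθ)
    (hs₁ : κc * ((ε₄ + B₀ * (2 * dL * C₁ * ε₁)) + B₀ * (4 * C2cov P.d * (ε₄ + B₀ * (2 * dL * C₁ * ε₁)) ^ 2)) ≤ c₁ * η ^ 2 * z)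
    (ha : κr * ((ε₄ + B₀ * (2 * dL * C₁ * ε₁)) + B₀ * (4 * C2cov P.d * (ε₄ + B₀ * (2 * dL * C₁ * ε₁)) ^ 2)) ≤ c₂ * η * z)
    (hma : m * (κr * ((ε₄ + B₀ * (2 * dL * C₁ * ε₁)) + B₀ * (4 * C2cov P.d * (ε₄ + B₀ * (2 * dL * C₁ * ε₁)) ^ 2))) ≤ 1)
    (hsm : 36 * (c₁ * z + m ^ 2 * c₂ ^ 2 * z ^ 2) / (rΦ / S - 1) ^ 2 ≤ δ * εθ)
    -- THE DISPLAYED γ3 INPUT OF RECORD (N-ne7cp1-g32-2 ∕ N-ne7cp1-g33-2 «COLLAR»; leaf-01-g8 l.18489, leaf-08-g14 l.18568):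
    -- radius `(d−1)·nb·a ≤ 2 sin(S∕2)`, a cover of the box plaquettes by a CORE set (⊇ the plaquettes of `□^∼`) and a COLLAR
    -- set, and the PAIR of readings — «sub-threshold ⟹ core plaquettes `a`-small» (B14 (2.16)–(2.17) + average regularity
    -- [Balaban1985Averaging] Props 1∕2 TYPE, from `u < θ`) and «`F ≠ 0` ⟹ collar plaquettes `a`-small» (the density's KEPT
    -- co-tests, B15 (1.3)–(1.9) TYPE — a SUPPORT property); located, NOT asserted — REPLACE `hreach′` of file 1 (hence
    -- `hFsupp` of S80 f3); binder NAMES = S87 f4's (`hn hN hΛbox hΛcomb ha0 hrad hcover hcore hcollar`; the two plaquette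
    -- sets are called `Pcore`∕`Pcollar` here because S80 f3 already uses `A` for the (S78) dressed action)
    {a : ℝ} (ha0 : 0 ≤ a) (hrad : ((P.d - 1 : ℕ) : ℝ) * nb * a ≤ 2 * Real.sin (S / 2))
    {Pcore Pcollar : Set (Plaq P j)} (hcover : boxPlaqs lo hi ⊆ Pcore ∪ Pcollar)
    (hcore : ∀ (V : GaugeField P j SU2) (y : ↥Λ → SU2),
      u (fixTo (combBonds lo hi) 1 (updateFinset V Λ y)) < εθ * η ^ 2 →
        PlaqSmallOn Pcore a (fixTo (combBonds lo hi) 1 (updateFinset V Λ y)))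
    (hcollar : ∀ (V : GaugeField P j SU2) (y : ↥Λ → SU2),
      F (fixTo (combBonds lo hi) 1 (updateFinset V Λ y)) ≠ 0 →
        PlaqSmallOn Pcollar a (fixTo (combBonds lo hi) 1 (updateFinset V Λ y))) :
    SlotAntiConcentration ((fieldMeasure P j SU2).withDensity F) u (εθ * η ^ 2) ρ
      (2 * ((m₀ : ℝ) + (3 * (|β| * ((dbar +
          2 * (κcb * (cH₁ * MH₁ * bw / ((1 - c𝒢 * M𝒢 * (2 * C₄w * a₃w * Real.exp (δw * rW))) *
              (1 - 2 * C2cov P.d * landauRad P.d P.L * Real.exp (δw * rC) * (cι * Mι) * (cH * MH)))) +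
            expTail₂ (mw * (κwb * (cH₁ * MH₁ * bw / ((1 - c𝒢 * M𝒢 * (2 * C₄w * a₃w * Real.exp (δw * rW))) *
              (1 - 2 * C2cov P.d * landauRad P.d P.L * Real.exp (δw * rC) * (cι * Mι) * (cH * MH))))))) / (rΦw / S)) *
          (2 * (κcb * (cH₁ * MH₁ * bw / ((1 - c𝒢 * M𝒢 * (2 * C₄w * a₃w * Real.exp (δw * rW))) *
              (1 - 2 * C2cov P.d * landauRad P.d P.L * Real.exp (δw * rC) * (cι * Mι) * (cH * MH)))) +
            expTail₂ (mw * (κwb * (cH₁ * MH₁ * bw / ((1 - c𝒢 * M𝒢 * (2 * C₄w * a₃w * Real.exp (δw * rW))) *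
              (1 - 2 * C2cov P.d * landauRad P.d P.L * Real.exp (δw * rC) * (cι * Mι) * (cH * MH))))))) / (rΦw / S))) * Kw) +
        (3 * (LK * (2 * ((ε₄e + B₀e * be) + B₀e * (4 * (C2cov P.d * Real.exp (2 * δ' * r₀e)) * (ε₄e + B₀e * be) ^ 2)))) / (rΦe / S - 1) + Bd))) / (1 - δ))  := by
  -- coarse junction: S98 `rowSum_coarse_le` then the displayed row `mult·K ≤ M·`; signs by positivity; pin∕sign rows by S69∕`pl1_nonneg`
  have hsgn : ∀ {mult : ℕ} {δ₁ M : ℝ}, δw < δ₁ → (mult : ℝ) * (2 * ((P.d : ℝ) + (δ₁ - δw)) / (δ₁ - δw)) ^ P.d ≤ M → 0 ≤ M :=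
    fun {mult δ₁ M} hgap hMc => by have ha := sub_pos.2 hgap; exact le_trans (by positivity) hMc
  exact slotAC_realized_su2_landauChart_assembled_decay_cfB7_lin_coTests_schur_elb
    hn hN Λ hΛbox hΛcomb e hS hSπ hF hFi hu hui hPu N hPuN holN hRN hθN hδ0N hδ1N hSMN hANN 𝒢 W𝒱 h𝒢 hW hB₀ hC₄ hε₄ hdL
    hC₁ hε₁ hB₃ h1 h2 h3 H₁ hH₁ T hTb hSr k Sf Sf' Sw Sw' Se Se' Ubg hUbg hα hα3 hα4 hα6 h52locw h52loce ϖe₁ ϖe₂ hϖe₁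
    hϖe₂ hreache ιs hι Hop hH h18 hcoup h3R ℓs hκ hℓ hlen hκc hcurl hδw (pinDist Bref hBref) (fun x y => pl1 (x - y))
    (pinDist_le_add Bref hBref) (fun x y => pl1_nonneg (x - y)) pos posz pos' posx posb k𝒢 kι kH kH₁ hc𝒢 (hsgn hgap𝒢
    hM𝒢c) hk𝒢 (fun x => (rowSum_coarse_le posz hmultz P.hd (sub_pos.2 hgap𝒢) x).trans hM𝒢c) hcι (hsgn hgapι hMιc) hkι
    (fun x => (rowSum_coarse_le pos hmultw P.hd (sub_pos.2 hgapι) x).trans hMιc) hcH (hsgn hgapH hMHc) hkH (fun x =>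
    (rowSum_coarse_le posx hmultx P.hd (sub_pos.2 hgapH) x).trans hMHc) hcH₁ (hsgn hgapH₁ hMH₁c) hkH₁ (fun x =>
    (rowSum_coarse_le posb hmultb P.hd (sub_pos.2 hgapH₁) x).trans hMH₁c) W𝒱w hB𝒢w hWw hB₀w hC₄w hε₄w hdomw hselfw
    hcontrw hBH₁w Tw hTbw h2Sw hιw hBHw hqw hRCw NW hlocW hreachW hreachC hsupp hqW hk Pw ℓw suppw ϖPw hblindw hdepthw
    hϖPw hκwb hκcb hℓwb hcurlw hlenw 𝓡𝒴w h𝓡𝒴w 𝓡𝒵w 𝓡ℬw h𝒢rw hWrw hιrw hHrw hH₁rw hTrw hskew Bp hBu hBd hd hdbar hKw hδ'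
    hϖ 𝒢e W𝒱e h𝒢e hWe hB₀e hC₄e hbe hε₄e hdome hselfe hcontre H₁e hH₁e Te hTbe hSre ιe hιe He hHe hqe hRCe I hrE hEd
    hEb supp hblind ϖP hdepth hK hcoupE μ hg A hint hpos hA hElb₂ L 𝓡𝒵 𝓡ℬ h𝒢r hWr hιr hHr hH₁r hTr hRdict hudict hδ0
    hδ1 hρ0 hρ hβ hη hεθ hs₁ ha hma hsm ha0 hrad hcover hcore hcollar

end Box

/-! ## §2 Non-vacuity of the entering rows (crew rule G-1) -/

section NonVacuity

/-- **THE ENTERING NUMBER ROWS ARE JOINTLY INHABITED WITH THE HOST's `M·`-ROWS, NON-DEGENERATELY** (crew rule G-1, parametric):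
for ANY `mult`, `d`, gap `a = δ· − δw > 0` and factor `X ≥ 0` (`hqW`'s `2·C₄w·a₃w·e^{δw rW}`, or the `hk`∕Schur-type products) there
are `M ≥ mult·(2(d+a)∕a)^d` (the junction `hM·c`) and a kernel size `c > 0` with `c·M·X < 1`, `c·M ≤ 1` — `hqW`, `hk`, `c·M ≤ B₀w`
(`B₀w ≥ 1`) stay satisfiable with NONZERO decay constants (`M := mult·K + 1`, `c := 1∕((M + 1)(X + 1))`). [folklore] -/
theorem junctionRows_inhabited (mult d : ℕ) {a X : ℝ} (ha : 0 < a) (hX : 0 ≤ X) :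
    ∃ M c : ℝ, (mult : ℝ) * (2 * ((d : ℝ) + a) / a) ^ d ≤ M ∧ 0 < M ∧ 0 < c ∧ c * M * X < 1 ∧ c * M ≤ 1 := by
  set K : ℝ := (mult : ℝ) * (2 * ((d : ℝ) + a) / a) ^ d with hKdef
  have hK0 : 0 ≤ K := by rw [hKdef]; positivity
  refine ⟨K + 1, 1 / ((K + 1 + 1) * (X + 1)), by linarith, by linarith, by positivity, ?_, ?_⟩
  · rw [show 1 / ((K + 1 + 1) * (X + 1)) * (K + 1) * X = ((K + 1) * X) / ((K + 1 + 1) * (X + 1)) by ring,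
      div_lt_one (by positivity)]; nlinarith
  · rw [show 1 / ((K + 1 + 1) * (X + 1)) * (K + 1) = (K + 1) / ((K + 1 + 1) * (X + 1)) by ring,
      div_le_one (by positivity)]; nlinarith

/-- **ONE-LINE NUMERIC INSTANCE** (sample values; `hk` read through the TREE identity `2·C2cov d·landauRad d L = 1` of leaf-06-g9's
F-ne7cleaf06g9-1, i.e. `hk ⟺ e^{δw rC}·(cι Mι)·(cH MH) < 1`): `d = 4`, `mult· = 1`, gaps `δ· − δw = 1` ⟹ `K = (2·5)^4 = 10⁴`, so
`M𝒢 = Mι = MH = 10⁴`; a RESTRICTION letter `cι = 1` (hence `cι Mι = 10⁴` — S110 makes the finding quantitative), `c𝒢 = 10⁻⁵`,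
`cH = 10⁻⁹`, `C₄w = 1∕16`, `a₃w = 1`, `δw·rW = δw·rC = 0`, `B₀w = 1`: `hM·c`, `hqW`, `hk`, `hB𝒢w`, `hBHw` hold together —
`10⁴ ≤ 10⁴`, `10⁻⁵·10⁴·(2·(1∕16)·1·e⁰) < 1`, `e⁰·(1·10⁴)·(10⁻⁹·10⁴) < 1`, `10⁻⁵·10⁴ ≤ 1`, `10⁻⁹·10⁴ ≤ 1` (as TYPED; whether a
(46)-letter can have `cH·MH = 10⁻⁵` is exactly F-ne7cleaf06g9-1's question — the owner's `RCw := 6X` repair, not this link). [folklore] -/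
example :
    (1 : ℝ) * (2 * ((4 : ℝ) + 1) / 1) ^ 4 ≤ 10000 ∧
      (1 / 100000 : ℝ) * 10000 * (2 * (1 / 16) * 1 * Real.exp (0 * 0)) < 1 ∧
      Real.exp (0 * 0) * ((1 : ℝ) * 10000) * (1 / 1000000000 * 10000) < 1 ∧
      (1 / 100000 : ℝ) * 10000 ≤ 1 ∧ (1 / 1000000000 : ℝ) * 10000 ≤ 1 := by
  norm_num

/-- **THE MULTIPLICITY ROWS ARE ALWAYS INHABITED** (`mult· := #Λ·`; the designed reading has `≤ m` indices per cell, S98). [folklore] -/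
example {Λw : Type*} [Fintype Λw] {d Nc : ℕ} (pos : Λw → TPt d Nc) (x : TPt d Nc) :
    (Finset.univ.filter fun b' => pos b' = x).card ≤ Fintype.card Λw := Finset.card_filter_le _ _

end NonVacuity

end Summit.QuantumFields.BalabanUV.T4Continuum.ShellMeasureLandauEndAssembledDecayCfLinCoTestsSchurCoarse

end
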